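import Literature.NumberTheory.Transcendental.StrongSixExponentialsExclusion
import Literature.NumberTheory.Transcendental.LinearSubgroupGaGmConstruction
import Literature.NumberTheory.Transcendental.AlgebraicGeneratorsField
import Literature.Barriers.Schanuel.AlgebraicIndependenceOfLogarithms
import HarnessLib

/-!
# The strong six exponentials theorem, III: the pencil case

Topic `Literature/NumberTheory/Transcendental`. Third file of the proof of the strong six
exponentials theorem (`Literature.Barriers.Schanuel.roy1992_strongSixExponentials`; Roy 1992 §4
Cor. 2 = [Waldschmidt2005, Thm 2.1] = [Waldschmidt2005, Thm 3.1, `d = 2`]) through Waldschmidt's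
linear subgroup theorem on `𝔾ₐ × 𝔾ₘ^N` (`linearSubgroup_GaGm`).

`strongSix_of_pencil`: a `2 × 3` matrix `M` with entries in `L̃ = ℚ̄ + ℚ̄·L`, rows independent
over `ℚ̄`, columns independent over `ℚ̄`, and SOME non-trivial `ℚ̄`-combination of the rows with
entries in `ℚ̄·L` (the "pencil", or constant-rank `≤ 1`, case) has rank `2`. The remaining case
(the constant parts of the entries form a rank-`2` pattern) needs the linear subgroup theorem on
`𝔾ₐ² × 𝔾ₘ^N` and is treated separately.

The proof: if `rank M ≤ 1` the columns are `a_j (1, t')` after the `GL₂(ℚ̄)` change of rows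
bringing the pencil row second, with `t' ∉ ℚ̄`, `a_j ∈ L̃` independent over `ℚ̄` and
`t' a_j ∈ ℚ̄·L` (`strongSix_of_pencil` → `false_of_pencil_data`); a finite set of logarithms
`ℓ_k` carries the six numbers (`false_of_setting`); the coefficient field `K₀ = ℚ(β)`, a
`ℚ`-basis `ω₀ = 1, …` of `K₀`, the integer coordinates `n = N₀·(ω-coordinates)` and the field
`K = K₀(e^{ℓ_k/N₀})` give the `3D` generators `ω_r(a_j, t'a_j)` of `𝔾ₐ × 𝔾ₘ^{2D}` inside the
hyperplane `V = {t'(z + ω·x) = ω·y}`, with letters spanning `W = {z + ω·x = 0 = ω·y}`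
(`false_of_instance`); the linear subgroup theorem `linearSubgroup_GaGm` then yields an
obstructing subgroup, excluded by `exclusion` (`StrongSixExponentialsExclusion.lean`).
Everything is PROVED; no named facts. Baker's theorem is not used.

## References

* [Waldschmidt2005] M. Waldschmidt, *Variations on the six exponentials theorem*, Algebra and
  Number Theory (Hyderabad 2003), Hindustan Book Agency 2005, 338–355, Thm 2.1, Thm 3.1, §3.
* D. Roy, *Matrices whose coefficients are linear forms in logarithms*, J. Number Theory 41 (1992),
  22–47, §4 Cor. 2.
* [Waldschmidt1988] M. Waldschmidt, *On the transcendence methods of Gel'fond and Schneider in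
  several variables*, New Advances in Transcendence Theory, CUP 1988, Ch. 24, Thm 4.1.
-/

noncomputable section

open Module Submodule

namespace Literature.NumberTheory.Transcendental.StrongSixExponentials

/-! ### The instance of the linear subgroup theorem and the contradiction -/

section Core

open GaGm DiazZL Complex LinearSubgroupGaGm

attribute [-simp] Fin.natAdd_eq_addNat

/-- **A common denominator** for finitely many elements of a number field. [folklore] -/
theorem exists_common_den {K : Type*} [Field K] [NumberField K] {ι : Type*} [Fintype ι] (x : ι → K) :
    ∃ b : ℕ, 1 ≤ b ∧ ∀ i, IsIntegral ℤ ((b : K) * x i) := by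
  classical
  have h1 : ∀ i, ∃ y : ℤ, y ≠ 0 ∧ IsIntegral ℤ ((y : K) * x i) := by
    intro i
    have hQ : IsAlgebraic ℚ (x i) := Algebra.IsAlgebraic.isAlgebraic _
    have hz : IsAlgebraic ℤ (x i) := (IsFractionRing.isAlgebraic_iff ℤ ℚ K).mpr hQ
    obtain ⟨y, hy, hint⟩ := hz.exists_integral_multiple
    exact ⟨y, hy, by simpa [zsmul_eq_mul] using hint⟩
  choose y hy hint using h1
  refine ⟨(∏ i, y i).natAbs, Nat.one_le_iff_ne_zero.mpr (Int.natAbs_ne_zero.mpr (Finset.prod_ne_zero_iff.mpr fun i _ => hy i)),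
    fun i => ?_⟩
  · have hcast : ((∏ i, y i).natAbs : K) = ((∏ i, y i).sign : ℤ) * ((∏ j ∈ Finset.univ.erase i, y j : ℤ) : K) * (y i : K) := by
      have h0 : ((∏ i, y i).natAbs : ℤ) = (∏ i, y i).sign * ∏ i, y i := by
        rw [Int.sign_mul_self_eq_natAbs]
      have : (((∏ i, y i).natAbs : ℤ) : K) = ((∏ i, y i).natAbs : K) := Int.cast_natCast _
      rw [← this, h0, ← Finset.mul_prod_erase Finset.univ y (Finset.mem_univ i)]
      push_cast; ring
    rw [hcast, mul_assoc]
    refine IsIntegral.mul ?_ (hint i)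
    exact_mod_cast isIntegral_algebraMap (R := ℤ) (A := K) (x := (∏ i, y i).sign * ∏ j ∈ Finset.univ.erase i, y j)

/-- **The contradiction, instance level.** Given the encoded data of the pencil case — a number
field `K ⊆ ℂ`, `ω₀ = 1, …, ω_{D'}` in `K` independent over `ℚ`, `t ∉ K`, `a_j` independent over `K`,
algebraic `θ_k`, `Θ_{kh} = e^{z_{hk}} ∈ K^×` with `ω_r a_j = θ_{jr} + ω·x_{jr}`,
`ω_r t a_j = ω·y_{jr}` — the linear subgroup theorem `linearSubgroup_GaGm` on `𝔾ₐ × 𝔾ₘ^{2D}` with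
`V = {t(z + ω·x) = ω·y}`, `W = {z + ω·x = 0, ω·y = 0}` and the `3D` generators
`(θ_k, (z_{hk})_h)` produces an obstructing subgroup, which `exclusion` rules out.
[cite: Waldschmidt2005, Thm 3.1 (d = 2) and its proof via the linear subgroup theorem] -/
theorem false_of_instance (K : IntermediateField ℚ ℂ) [NumberField K] {D' : ℕ}
    (ω : Fin (D' + 1) → ℂ) (hωK : ∀ s, ω s ∈ K) (hω : LinearIndependent ℚ ω) (hω0 : ω 0 = 1)
    (t : ℂ) (ht : t ∉ K) (a : Fin 3 → ℂ)
    (ha : ∀ κ : Fin 3 → ℂ, (∀ j, κ j ∈ K) → ∑ j, κ j * a j = 0 → ∀ j, κ j = 0)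
    (θ : Fin (3 * (D' + 1)) → K)
    (Θ : Fin (3 * (D' + 1)) → Fin ((D' + 1) + (D' + 1)) → K) (hΘ : ∀ k h, Θ k h ≠ 0)
    (z : Fin ((D' + 1) + (D' + 1)) → Fin (3 * (D' + 1)) → ℂ) (hz : ∀ h k, cexp (z h k) = Θ k h)
    (hx : ∀ k, ω (finProdFinEquiv.symm k).2 * a (finProdFinEquiv.symm k).1 =
      θ k + ∑ s, ω s * z (Fin.castAdd (D' + 1) s) k)
    (hy : ∀ k, ω (finProdFinEquiv.symm k).2 * (t * a (finProdFinEquiv.symm k).1) =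
      ∑ s, ω s * z (Fin.natAdd (D' + 1) s) k) : False := by
  classical
  set σ : K →+* ℂ := algebraMap K ℂ with hσ
  have hσapp : ∀ x : K, σ x = (x : ℂ) := fun x => rfl
  have ht0 : t ≠ 0 := fun h => ht (h ▸ K.zero_mem)
  -- the hyperplane `V = ker Φ`, `Φ(z, x, y) = t (z + ω·x) - ω·y`
  let Φ : (ℂ × (Fin ((D' + 1) + (D' + 1)) → ℂ)) →ₗ[ℂ] ℂ :=
    { toFun := fun w => t * (w.1 + ∑ s, ω s * w.2 (Fin.castAdd (D' + 1) s)) - ∑ s, ω s * w.2 (Fin.natAdd (D' + 1) s)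
      map_add' := fun w w' => by
        simp only [Prod.fst_add, Prod.snd_add, Pi.add_apply, mul_add, Finset.sum_add_distrib]; ring
      map_smul' := fun c w => by
        simp only [Prod.smul_fst, Prod.smul_snd, Pi.smul_apply, smul_eq_mul, RingHom.id_apply]; ring_nf
        simp only [Finset.mul_sum]; ring_nf }
  have hΦ : ∀ w : ℂ × (Fin ((D' + 1) + (D' + 1)) → ℂ),
      Φ w = t * (w.1 + ∑ s, ω s * w.2 (Fin.castAdd (D' + 1) s)) - ∑ s, ω s * w.2 (Fin.natAdd (D' + 1) s) := fun w => rfl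
  set V : Submodule ℂ (ℂ × (Fin ((D' + 1) + (D' + 1)) → ℂ)) := LinearMap.ker Φ with hV
  -- `e₀ = (1; 0; t e₀) ∈ V`
  let e₀ : ℂ × (Fin ((D' + 1) + (D' + 1)) → ℂ) :=
    (1, Fin.append (0 : Fin (D' + 1) → ℂ) (fun s => if s = 0 then t else 0))
  have he₀ : e₀ ∈ V := by
    rw [hV, LinearMap.mem_ker, hΦ]
    simp only [e₀, Fin.append_left, Fin.append_right, Pi.zero_apply, mul_zero, Finset.sum_const_zero, add_zero,
      mul_ite, Finset.sum_ite_eq', Finset.mem_univ, if_true, hω0]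
    ring
  obtain ⟨m, bV, hb0, hbi, hdimV⟩ := exists_adapted_basis V e₀ he₀ rfl
  -- `dim V = N`
  have hfinV : finrank ℂ V = (D' + 1) + (D' + 1) := by
    have hsurj : Function.Surjective Φ := by
      intro c
      refine ⟨((c / t : ℂ), (0 : Fin ((D' + 1) + (D' + 1)) → ℂ)), ?_⟩
      rw [hΦ]; simp [mul_div_cancel₀ _ ht0]
    have h1 := LinearMap.finrank_range_add_finrank_ker Φ
    rw [LinearMap.range_eq_top.mpr hsurj, finrank_top, Module.finrank_self, Module.finrank_prod, Module.finrank_self,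
      Module.finrank_fintype_fun_eq_card, Fintype.card_fin] at h1
    rw [hV]; omega
  have hm : m = (D' + 1) + D' := by rw [hdimV] at hfinV; omega
  subst hm
  -- the letters
  let ωK : Fin (D' + 1) → K := fun s => ⟨ω s, hωK s⟩
  have hωKC : ∀ s, ((ωK s : K) : ℂ) = ω s := fun s => rfl
  let εx : Fin (D' + 1) → K × (Fin ((D' + 1) + (D' + 1)) → K) := fun s =>
    (-ωK s, fun h => if h = Fin.castAdd (D' + 1) s then 1 else 0)
  let εy : Fin D' → K × (Fin ((D' + 1) + (D' + 1)) → K) := fun u =>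
    (0, fun h => if h = Fin.natAdd (D' + 1) u.succ then 1 else
      if h = Fin.natAdd (D' + 1) 0 then -ωK u.succ else 0)
  let εK : Fin ((D' + 1) + D') → K × (Fin ((D' + 1) + (D' + 1)) → K) := Fin.append εx εy
  let eC : Fin ((D' + 1) + D') → ℂ × (Fin ((D' + 1) + (D' + 1)) → ℂ) := fun l' =>
    ((σ (εK l').1, fun h => σ ((εK l').2 h)))
  -- explicit complex forms of the letters
  have hne_xy : ∀ (s s' : Fin (D' + 1)), (Fin.castAdd (D' + 1) s : Fin ((D' + 1) + (D' + 1))) ≠ Fin.natAdd (D' + 1) s' := by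
    intro s s' h
    have := congrArg Fin.val h
    simp only [Fin.val_castAdd, Fin.val_natAdd] at this; omega
  have hne_yx : ∀ (s s' : Fin (D' + 1)), (Fin.natAdd (D' + 1) s : Fin ((D' + 1) + (D' + 1))) ≠ Fin.castAdd (D' + 1) s' :=
    fun s s' h => hne_xy s' s h.symm
  have hxinj : ∀ (s s' : Fin (D' + 1)), (Fin.castAdd (D' + 1) s : Fin ((D' + 1) + (D' + 1))) = Fin.castAdd (D' + 1) s' ↔ s = s' :=
    fun s s' => Fin.castAdd_inj
  have hyinj : ∀ (s s' : Fin (D' + 1)), (Fin.natAdd (D' + 1) s : Fin ((D' + 1) + (D' + 1))) = Fin.natAdd (D' + 1) s' ↔ s = s' :=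
    fun s s' => Fin.natAdd_inj _
  have heCx : ∀ s, eC (Fin.castAdd D' s) = (-ω s, fun h => if h = Fin.castAdd (D' + 1) s then 1 else 0) := by
    intro s
    simp only [eC, εK, Fin.append_left, εx, hσapp]
    congr 1
    funext h
    by_cases hh : h = Fin.castAdd (D' + 1) s <;> simp [hh]
  have heCy : ∀ u, eC (Fin.natAdd (D' + 1) u) = (0, fun h => if h = Fin.natAdd (D' + 1) u.succ then 1 else
      if h = Fin.natAdd (D' + 1) 0 then -ω u.succ else 0) := by
    intro u
    simp only [eC, εK, Fin.append_right, εy, hσapp]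
    congr 1
    funext h
    by_cases hh : h = Fin.natAdd (D' + 1) u.succ
    · simp [hh]
    · by_cases hh' : h = Fin.natAdd (D' + 1) 0
      · subst hh'
        simp [hyinj, (Fin.succ_ne_zero u).symm, hωKC]
      · simp [hh, hh']
  -- evaluation of the two coordinate sums on the letters
  have hsumx_x : ∀ s, ∑ s', ω s' * (if (Fin.castAdd (D' + 1) s' : Fin ((D' + 1) + (D' + 1))) = Fin.castAdd (D' + 1) s
      then (1 : ℂ) else 0) = ω s := by
    intro s; simp only [hxinj, mul_ite, mul_one, mul_zero, Finset.sum_ite_eq', Finset.mem_univ, if_true]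
  have hsumy_x : ∀ s, ∑ s', ω s' * (if (Fin.natAdd (D' + 1) s' : Fin ((D' + 1) + (D' + 1))) = Fin.castAdd (D' + 1) s
      then (1 : ℂ) else 0) = 0 := by
    intro s; simp only [hne_yx, if_false, mul_zero, Finset.sum_const_zero]
  have hsumx_y : ∀ u : Fin D', ∑ s', ω s' * (if (Fin.castAdd (D' + 1) s' : Fin ((D' + 1) + (D' + 1))) = Fin.natAdd (D' + 1) u.succ
      then (1 : ℂ) else if (Fin.castAdd (D' + 1) s' : Fin ((D' + 1) + (D' + 1))) = Fin.natAdd (D' + 1) 0 then -ω u.succ else 0) = 0 := by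
    intro u; simp only [hne_xy, if_false, mul_zero, Finset.sum_const_zero]
  have hsumy_y : ∀ u : Fin D', ∑ s', ω s' * (if (Fin.natAdd (D' + 1) s' : Fin ((D' + 1) + (D' + 1))) = Fin.natAdd (D' + 1) u.succ
      then (1 : ℂ) else if (Fin.natAdd (D' + 1) s' : Fin ((D' + 1) + (D' + 1))) = Fin.natAdd (D' + 1) 0 then -ω u.succ else 0) = 0 := by
    intro u
    simp only [hyinj]
    rw [Fin.sum_univ_succ]
    simp only [(Fin.succ_ne_zero u).symm, if_false, if_true, Fin.succ_inj, Fin.succ_ne_zero, hω0, one_mul]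
    simp only [mul_ite, mul_one, mul_zero, Finset.sum_ite_eq', Finset.mem_univ, if_true]
    ring
  -- the letters lie in `V`
  have heV : ∀ l', eC l' ∈ V := by
    intro l'
    rw [hV, LinearMap.mem_ker, hΦ]
    refine Fin.addCases (fun s => ?_) (fun u => ?_) l'
    · rw [heCx]; simp only; rw [hsumx_x, hsumy_x]; ring
    · rw [heCy]; simp only; rw [hsumx_y, hsumy_y]; ring
  -- the generators lie in `V`
  have hyV : ∀ k, ((σ (θ k), fun h => z h k) : ℂ × (Fin ((D' + 1) + (D' + 1)) → ℂ)) ∈ V := by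
    intro k
    rw [hV, LinearMap.mem_ker, hΦ, hσapp]
    simp only
    rw [← hx k, ← hy k]; ring
  -- the letters are independent: `dim W = N - 1`
  set W := Submodule.span ℂ (Set.range eC) with hWdef
  have hWle : ∀ w ∈ W, w.1 + ∑ s, ω s * w.2 (Fin.castAdd (D' + 1) s) = 0 ∧ ∑ s, ω s * w.2 (Fin.natAdd (D' + 1) s) = 0 := by
    -- `W'` as a submodule
    let W' : Submodule ℂ (ℂ × (Fin ((D' + 1) + (D' + 1)) → ℂ)) :=
      { carrier := {w | w.1 + ∑ s, ω s * w.2 (Fin.castAdd (D' + 1) s) = 0 ∧ ∑ s, ω s * w.2 (Fin.natAdd (D' + 1) s) = 0}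
        zero_mem' := by simp
        add_mem' := fun {w w'} hw hw' => by
          simp only [Set.mem_setOf_eq, Prod.fst_add, Prod.snd_add, Pi.add_apply, mul_add, Finset.sum_add_distrib] at *
          exact ⟨by linear_combination hw.1 + hw'.1, by linear_combination hw.2 + hw'.2⟩
        smul_mem' := fun c w hw => by
          simp only [Set.mem_setOf_eq, Prod.smul_fst, Prod.smul_snd, Pi.smul_apply, smul_eq_mul] at *
          constructor
          · have := congrArg (fun x => c * x) hw.1
            simp only [mul_add, mul_zero, Finset.mul_sum] at this
            rw [← this]; congr 1; exact Finset.sum_congr rfl fun s _ => by ring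
          · have := congrArg (fun x => c * x) hw.2
            simp only [mul_zero, Finset.mul_sum] at this
            rw [← this]; exact Finset.sum_congr rfl fun s _ => by ring }
    have hle : W ≤ W' := by
      rw [hWdef, Submodule.span_le]
      rintro _ ⟨l', rfl⟩
      show (eC l').1 + ∑ s, ω s * (eC l').2 (Fin.castAdd (D' + 1) s) = 0 ∧ ∑ s, ω s * (eC l').2 (Fin.natAdd (D' + 1) s) = 0
      refine Fin.addCases (fun s => ?_) (fun u => ?_) l'
      · rw [heCx]; simp only; rw [hsumx_x, hsumy_x]; exact ⟨by ring, rfl⟩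
      · rw [heCy]; simp only; rw [hsumx_y, hsumy_y]; exact ⟨by ring, rfl⟩
    intro w hw; exact hle hw
  have hWind : LinearIndependent ℂ eC := by
    rw [Fintype.linearIndependent_iff]
    intro g hg
    have hg2 : ∀ h, ∑ l', g l' * (eC l').2 h = 0 := fun h => by
      have := congrArg (fun w : ℂ × (Fin ((D' + 1) + (D' + 1)) → ℂ) => w.2 h) hg
      simpa [Finset.sum_apply, Prod.snd_sum] using this
    intro l'
    refine Fin.addCases (fun s => ?_) (fun u => ?_) l'
    · have := hg2 (Fin.castAdd (D' + 1) s)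
      rw [Fin.sum_univ_add] at this
      simp only [heCx, heCy, hxinj, hne_xy, if_false, mul_ite, mul_one, mul_zero, Finset.sum_ite_eq,
        Finset.mem_univ, if_true, Finset.sum_const_zero, add_zero] at this
      exact this
    · have := hg2 (Fin.natAdd (D' + 1) u.succ)
      rw [Fin.sum_univ_add] at this
      simp only [heCx, heCy, hne_yx, hyinj, if_false, mul_zero, Finset.sum_const_zero, zero_add,
        Fin.succ_inj, Fin.succ_ne_zero, mul_ite, mul_one, Finset.sum_ite_eq, Finset.mem_univ,
        if_true] at this
      exact this
  have hWdim : (D' + 1) + (D' + 1) ≤ finrank ℂ W + 1 := by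
    rw [hWdef, finrank_span_eq_card hWind, Fintype.card_fin]; omega
  have hWpos : 0 < finrank ℂ W := by omega
  -- integrality
  obtain ⟨b, hb, hbint⟩ := exists_common_den (K := K)
    (Sum.elim θ (Sum.elim (fun p : Fin (3 * (D' + 1)) × Fin ((D' + 1) + (D' + 1)) => Θ p.1 p.2)
      (Sum.elim (fun l' => (εK l').1) (fun p : Fin ((D' + 1) + D') × Fin ((D' + 1) + (D' + 1)) => (εK p.1).2 p.2))))
  -- the linear subgroup theorem
  obtain ⟨H, -, r', ρ, hρ, hmemρ, h1, h2⟩ := linearSubgroup_GaGm σ (n := (D' + 1) + D') (m' := (D' + 1) + D') le_rfl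
    θ Θ hΘ z (fun h k => by rw [hz h k, hσapp]) εK V bV (by rw [hb0]) hbi hyV heV hWpos hb
    (fun k => hbint (Sum.inl k)) (fun k h => hbint (Sum.inr (Sum.inl (k, h))))
    (fun l' => ⟨hbint (Sum.inr (Sum.inr (Sum.inl l'))), fun h => hbint (Sum.inr (Sum.inr (Sum.inr (l', h))))⟩)
  -- the exclusion
  exact exclusion (D := D' + 1) (Nat.succ_pos D') K ω hωK hω t ht finProdFinEquiv a ha (fun k => (θ k : ℂ)) z hx hy
    H ρ hρ hmemρ W hWle hWdim h1 h2

/-- **Common denominator of finitely many rationals.** [folklore] -/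
theorem exists_common_nat_denom {ι : Type*} [Fintype ι] (f : ι → ℚ) :
    ∃ N₀ : ℕ, 0 < N₀ ∧ ∀ i, ∃ n : ℤ, (n : ℚ) = f i * N₀ := by
  classical
  refine ⟨∏ i, (f i).den, Finset.prod_pos fun i _ => (f i).den_pos, fun i => ?_⟩
  refine ⟨(f i).num * ∏ j ∈ Finset.univ.erase i, ((f j).den : ℤ), ?_⟩
  rw [← Finset.mul_prod_erase Finset.univ (fun j => (f j).den) (Finset.mem_univ i)]
  push_cast
  rw [← mul_assoc, Rat.mul_den_eq_num]

/-- **The contradiction, setting level** (`= [Waldschmidt2005, Thm 3.1]` for `d = 2` in the pencil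
case): there are no `t ∉ ℚ̄`, `a₁, a₂, a₃ ∈ ℂ` linearly independent over `ℚ̄` and logarithms of
algebraic numbers `ℓ_k` with `a_j ∈ ℚ̄ + ∑ ℚ̄ ℓ_k` and `t a_j ∈ ∑ ℚ̄ ℓ_k`. The coefficient field
`K₀ = ℚ(β)` with a `ℚ`-basis `ω₀ = 1, …, ω_{D'}`, the integers `n = N₀ · (ω-coordinates)` and the
rescaled logarithms `ℓ_k / N₀` furnish the instance of `false_of_instance` over
`K = K₀(e^{ℓ_k/N₀})`. [cite: Waldschmidt2005, Thm 3.1 and §3 (proof of Thm 2.11 as a consequence of Thm 3.1)] -/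
theorem false_of_setting {q : ℕ} (ℓ : Fin q → ℂ) (hℓalg : ∀ k, IsAlgebraic ℚ (cexp (ℓ k)))
    (t : ℂ) (ht : Transcendental ℚ t) (a : Fin 3 → ℂ) (ha : LinearIndependent (algebraicClosure ℚ ℂ) a)
    (β₀ : Fin 3 → ℂ) (β β' : Fin 3 → Fin q → ℂ)
    (hβ₀ : ∀ j, IsAlgebraic ℚ (β₀ j)) (hβ : ∀ j k, IsAlgebraic ℚ (β j k)) (hβ' : ∀ j k, IsAlgebraic ℚ (β' j k))
    (haj : ∀ j, a j = β₀ j + ∑ k, β j k * ℓ k) (htaj : ∀ j, t * a j = ∑ k, β' j k * ℓ k) : False := by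
  classical
  -- the coefficient field `K₀ = ℚ(β)` and its basis `ω`
  let G₀ : AlgGens :=
    { ι := Fin 3 ⊕ ((Fin 3 × Fin q) ⊕ (Fin 3 × Fin q))
      a := Sum.elim β₀ (Sum.elim (fun p => β p.1 p.2) (fun p => β' p.1 p.2))
      alg := by rintro (j | ⟨j, k⟩ | ⟨j, k⟩) <;> simp [hβ₀, hβ, hβ'] }
  obtain ⟨D', ω, hω0, -⟩ := exists_basis_head_one G₀.K
  let ωC : Fin (D' + 1) → ℂ := fun s => ((ω s : G₀.K) : ℂ)
  have hωC0 : ωC 0 = 1 := by simp [ωC, hω0]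
  have hωCind : LinearIndependent ℚ ωC :=
    ω.linearIndependent.map' (G₀.K.val.toLinearMap) (LinearMap.ker_eq_bot.mpr (algebraMap G₀.K ℂ).injective)
  let b0 : Fin 3 → G₀.K := fun j => G₀.genK (Sum.inl j)
  let bq : Fin 3 → Fin q → G₀.K := fun j k => G₀.genK (Sum.inr (Sum.inl (j, k)))
  let bq' : Fin 3 → Fin q → G₀.K := fun j k => G₀.genK (Sum.inr (Sum.inr (j, k)))
  have hb0 : ∀ j, ((b0 j : G₀.K) : ℂ) = β₀ j := fun j => rfl
  have hbq : ∀ j k, ((bq j k : G₀.K) : ℂ) = β j k := fun j k => rfl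
  have hbq' : ∀ j k, ((bq' j k : G₀.K) : ℂ) = β' j k := fun j k => rfl
  -- rational coordinates of `ω_r β_{jk}`, `ω_r β'_{jk}` and a common denominator
  let Qx : Fin (D' + 1) → Fin 3 → Fin q → Fin (D' + 1) → ℚ := fun r j k s => ω.repr (ω r * bq j k) s
  let Qy : Fin (D' + 1) → Fin 3 → Fin q → Fin (D' + 1) → ℚ := fun r j k s => ω.repr (ω r * bq' j k) s
  have hcoe_repr : ∀ x : G₀.K, (x : ℂ) = ∑ s, (ω.repr x s : ℂ) * ωC s := by
    intro x
    conv_lhs => rw [← ω.sum_repr x]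
    rw [IntermediateField.coe_sum]
    refine Finset.sum_congr rfl fun s _ => ?_
    rw [IntermediateField.coe_smul, Rat.smul_def]
  have hQx : ∀ r j k, ωC r * β j k = ∑ s, (Qx r j k s : ℂ) * ωC s := by
    intro r j k; rw [← hbq, ← IntermediateField.coe_mul]; exact hcoe_repr _
  have hQy : ∀ r j k, ωC r * β' j k = ∑ s, (Qy r j k s : ℂ) * ωC s := by
    intro r j k; rw [← hbq', ← IntermediateField.coe_mul]; exact hcoe_repr _
  obtain ⟨N₀, hN₀, hN⟩ := exists_common_nat_denom
    (Sum.elim (fun p : Fin (D' + 1) × Fin 3 × Fin q × Fin (D' + 1) => Qx p.1 p.2.1 p.2.2.1 p.2.2.2)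
      (fun p : Fin (D' + 1) × Fin 3 × Fin q × Fin (D' + 1) => Qy p.1 p.2.1 p.2.2.1 p.2.2.2))
  choose nn hnn using hN
  let nx : Fin (D' + 1) → Fin 3 → Fin q → Fin (D' + 1) → ℤ := fun r j k s => nn (Sum.inl (r, j, k, s))
  let ny : Fin (D' + 1) → Fin 3 → Fin q → Fin (D' + 1) → ℤ := fun r j k s => nn (Sum.inr (r, j, k, s))
  have hnx : ∀ r j k s, (nx r j k s : ℂ) = (Qx r j k s : ℂ) * N₀ := by
    intro r j k s; have := hnn (Sum.inl (r, j, k, s)); simp only [Sum.elim_inl] at this; exact_mod_cast this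
  have hny : ∀ r j k s, (ny r j k s : ℂ) = (Qy r j k s : ℂ) * N₀ := by
    intro r j k s; have := hnn (Sum.inr (r, j, k, s)); simp only [Sum.elim_inr] at this; exact_mod_cast this
  have hN₀C : (N₀ : ℂ) ≠ 0 := by exact_mod_cast hN₀.ne'
  -- rescaled logarithms and the logarithmic coordinates
  let ℓ' : Fin q → ℂ := fun k => ℓ k / N₀
  have hℓ'alg : ∀ k, IsAlgebraic ℚ (cexp (ℓ' k)) := by
    intro k
    refine IsAlgebraic.of_pow hN₀ ?_
    rw [← Complex.exp_nat_mul]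
    have : (N₀ : ℂ) * ℓ' k = ℓ k := by simp only [ℓ']; field_simp
    rw [this]; exact hℓalg k
  let μ : Fin (D' + 1) → Fin 3 → Fin (D' + 1) → ℂ := fun r j s => ∑ k, (nx r j k s : ℂ) * ℓ' k
  let μ' : Fin (D' + 1) → Fin 3 → Fin (D' + 1) → ℂ := fun r j s => ∑ k, (ny r j k s : ℂ) * ℓ' k
  have hidX : ∀ r j, ωC r * a j = ωC r * β₀ j + ∑ s, ωC s * μ r j s := by
    intro r j
    rw [haj j, mul_add, Finset.mul_sum]
    congr 1
    calc ∑ k, ωC r * (β j k * ℓ k) = ∑ k, ∑ s, (Qx r j k s : ℂ) * ωC s * ℓ k := by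
          refine Finset.sum_congr rfl fun k _ => ?_
          rw [← mul_assoc, hQx, Finset.sum_mul]
      _ = ∑ s, ∑ k, (Qx r j k s : ℂ) * ωC s * ℓ k := Finset.sum_comm
      _ = ∑ s, ωC s * μ r j s := by
          refine Finset.sum_congr rfl fun s _ => ?_
          simp only [μ, ℓ', Finset.mul_sum]
          refine Finset.sum_congr rfl fun k _ => ?_
          rw [hnx]; field_simp
  have hidY : ∀ r j, ωC r * (t * a j) = ∑ s, ωC s * μ' r j s := by
    intro r j
    rw [htaj j, Finset.mul_sum]
    calc ∑ k, ωC r * (β' j k * ℓ k) = ∑ k, ∑ s, (Qy r j k s : ℂ) * ωC s * ℓ k := by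
          refine Finset.sum_congr rfl fun k _ => ?_
          rw [← mul_assoc, hQy, Finset.sum_mul]
      _ = ∑ s, ∑ k, (Qy r j k s : ℂ) * ωC s * ℓ k := Finset.sum_comm
      _ = ∑ s, ωC s * μ' r j s := by
          refine Finset.sum_congr rfl fun s _ => ?_
          simp only [μ', ℓ', Finset.mul_sum]
          refine Finset.sum_congr rfl fun k _ => ?_
          rw [hny]; field_simp
  -- the field `K = K₀(e^{ℓ'_k})`
  let G : AlgGens :=
    { ι := G₀.ι ⊕ Fin q
      a := Sum.elim G₀.a fun k => cexp (ℓ' k)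
      alg := by
        rintro (i | k)
        · exact G₀.alg i
        · exact hℓ'alg k }
  have hK₀K : G₀.K ≤ G.K := by
    refine IntermediateField.adjoin.mono ℚ _ _ ?_
    rintro _ ⟨i, rfl⟩; exact ⟨Sum.inl i, rfl⟩
  have hmemK_alg : ∀ x : ℂ, x ∈ G.K → IsAlgebraic ℚ x := by
    intro x hx
    have : IsAlgebraic ℚ (⟨x, hx⟩ : G.K) := Algebra.IsAlgebraic.isAlgebraic _
    exact this.algHom G.K.val
  -- the instance data
  have hωK : ∀ s, ωC s ∈ G.K := fun s => hK₀K (ω s).2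
  have htK : t ∉ G.K := fun h => ht (hmemK_alg t h)
  have haK : ∀ κ : Fin 3 → ℂ, (∀ j, κ j ∈ G.K) → ∑ j, κ j * a j = 0 → ∀ j, κ j = 0 := by
    intro κ hκ hsum j
    let g : Fin 3 → algebraicClosure ℚ ℂ := fun j => ⟨κ j, mem_algebraicClosure_iff.mpr (hmemK_alg _ (hκ j))⟩
    have := Fintype.linearIndependent_iff.mp ha g (by
      simpa [g, IntermediateField.smul_def, smul_eq_mul] using hsum) j
    simpa [g] using congrArg (fun x : algebraicClosure ℚ ℂ => (x : ℂ)) this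
  let jr : Fin (3 * (D' + 1)) → Fin 3 × Fin (D' + 1) := fun k => finProdFinEquiv.symm k
  let θ : Fin (3 * (D' + 1)) → G.K := fun k =>
    ⟨ωC (jr k).2 * β₀ (jr k).1, G.K.mul_mem (hωK _) (hK₀K (b0 (jr k).1).2)⟩
  have hθ : ∀ k, ((θ k : G.K) : ℂ) = ωC (jr k).2 * β₀ (jr k).1 := fun k => rfl
  let αK : Fin q → G.K := fun k => G.genK (Sum.inr k)
  have hαK : ∀ k, ((αK k : G.K) : ℂ) = cexp (ℓ' k) := fun k => rfl
  have hαK0 : ∀ k, αK k ≠ 0 := by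
    intro k h
    have := congrArg (fun x : G.K => (x : ℂ)) h
    rw [hαK] at this; exact Complex.exp_ne_zero _ this
  let Θ : Fin (3 * (D' + 1)) → Fin ((D' + 1) + (D' + 1)) → G.K := fun k =>
    Fin.append (fun s => ∏ k', αK k' ^ (nx (jr k).2 (jr k).1 k' s)) (fun s => ∏ k', αK k' ^ (ny (jr k).2 (jr k).1 k' s))
  have hΘ0 : ∀ k h, Θ k h ≠ 0 := by
    intro k h
    refine Fin.addCases (fun s => ?_) (fun s => ?_) h
    · simp only [Θ, Fin.append_left]; exact Finset.prod_ne_zero_iff.mpr fun k' _ => zpow_ne_zero _ (hαK0 k')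
    · simp only [Θ, Fin.append_right]; exact Finset.prod_ne_zero_iff.mpr fun k' _ => zpow_ne_zero _ (hαK0 k')
  let z : Fin ((D' + 1) + (D' + 1)) → Fin (3 * (D' + 1)) → ℂ := fun h k =>
    Fin.append (fun s => μ (jr k).2 (jr k).1 s) (fun s => μ' (jr k).2 (jr k).1 s) h
  have hcoe_prod : ∀ (n : Fin q → ℤ), (((∏ k', αK k' ^ (n k') : G.K)) : ℂ) = cexp (∑ k', (n k' : ℂ) * ℓ' k') := by
    intro n
    rw [Complex.exp_sum, IntermediateField.coe_prod]
    refine Finset.prod_congr rfl fun k' _ => ?_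
    rw [Complex.exp_int_mul, ← hαK]
    exact map_zpow₀ (algebraMap G.K ℂ) _ _
  have hz : ∀ h k, cexp (z h k) = ((Θ k h : G.K) : ℂ) := by
    intro h k
    refine Fin.addCases (fun s => ?_) (fun s => ?_) h
    · simp only [z, Θ, Fin.append_left]; rw [hcoe_prod]
    · simp only [z, Θ, Fin.append_right]; rw [hcoe_prod]
  have hx : ∀ k, ωC (finProdFinEquiv.symm k).2 * a (finProdFinEquiv.symm k).1 =
      θ k + ∑ s, ωC s * z (Fin.castAdd (D' + 1) s) k := by
    intro k
    simp only [z, Fin.append_left, hθ, jr]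
    exact hidX _ _
  have hy : ∀ k, ωC (finProdFinEquiv.symm k).2 * (t * a (finProdFinEquiv.symm k).1) =
      ∑ s, ωC s * z (Fin.natAdd (D' + 1) s) k := by
    intro k
    simp only [z, Fin.append_right, jr]
    exact hidY _ _
  exact false_of_instance G.K ωC hωK hωCind hωC0 t htK a haK θ Θ hΘ0 z hz hx hy

/-! ### From the matrix to the setting -/

open Literature.Barriers.Schanuel (logLinearForms)

local notation "Qb" => algebraicClosure ℚ ℂ

/-- **The pencil case, point form.** There are no `t ∉ ℚ̄` and `a₁, a₂, a₃ ∈ L̃`, linearly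
independent over `ℚ̄`, with `t a_j ∈ ℚ̄·L` (`L` = logarithms of algebraic numbers): choose a
finite set of logarithms carrying all six numbers and apply `false_of_setting`.
[cite: Waldschmidt2005, Thm 3.1 (d = 2)] -/
theorem false_of_pencil_data (t : ℂ) (ht : Transcendental ℚ t) (a : Fin 3 → ℂ)
    (ha : LinearIndependent (algebraicClosure ℚ ℂ) a) (haL : ∀ j, a j ∈ logLinearForms)
    (htaL : ∀ j, t * a j ∈ Submodule.span (algebraicClosure ℚ ℂ) {z : ℂ | IsAlgebraic ℚ (cexp z)}) : False := by
  classical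
  set L : Set ℂ := {z : ℂ | IsAlgebraic ℚ (cexp z)} with hL
  -- `a_j = β₀ + x_j`, `x_j ∈ span L`
  have hsplit : ∀ j, ∃ (β₀ : Qb) (x : ℂ), x ∈ Submodule.span Qb L ∧ a j = (β₀ : ℂ) + x := by
    intro j
    have h := haL j
    rw [logLinearForms, Submodule.span_union, Submodule.mem_sup] at h
    obtain ⟨y, hy, x, hx, hyx⟩ := h
    obtain ⟨β₀, rfl⟩ := Submodule.mem_span_singleton.mp hy
    exact ⟨β₀, x, hx, by rw [← hyx]; simp [IntermediateField.smul_def]⟩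
  choose β₀ x hx hax using hsplit
  -- finite sets of logarithms
  have hfin : ∀ j, ∃ T : Finset ℂ, (T : Set ℂ) ⊆ L ∧ x j ∈ Submodule.span Qb (T : Set ℂ) :=
    fun j => Submodule.mem_span_finite_of_mem_span (hx j)
  have hfin' : ∀ j, ∃ T : Finset ℂ, (T : Set ℂ) ⊆ L ∧ t * a j ∈ Submodule.span Qb (T : Set ℂ) :=
    fun j => Submodule.mem_span_finite_of_mem_span (htaL j)
  choose T hTL hxT using hfin
  choose T' hT'L htT' using hfin'
  set Λ : Finset ℂ := Finset.univ.biUnion T ∪ Finset.univ.biUnion T' with hΛ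
  have hΛL : (Λ : Set ℂ) ⊆ L := by
    intro m hm
    rw [hΛ, Finset.coe_union, Finset.coe_biUnion, Finset.coe_biUnion] at hm
    rcases hm with hm | hm
    · simp only [Finset.coe_univ, Set.mem_univ, Set.iUnion_true, Set.mem_iUnion] at hm
      obtain ⟨j, hj⟩ := hm; exact hTL j hj
    · simp only [Finset.coe_univ, Set.mem_univ, Set.iUnion_true, Set.mem_iUnion] at hm
      obtain ⟨j, hj⟩ := hm; exact hT'L j hj
  have hTΛ : ∀ j, (T j : Set ℂ) ⊆ Λ := fun j m hm => by
    rw [hΛ, Finset.coe_union]; exact Or.inl (by simpa using ⟨j, hm⟩)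
  have hT'Λ : ∀ j, (T' j : Set ℂ) ⊆ Λ := fun j m hm => by
    rw [hΛ, Finset.coe_union]; exact Or.inr (by simpa using ⟨j, hm⟩)
  -- enumerate `Λ`
  set q := Λ.card
  let ℓ : Fin q → ℂ := fun k => (Λ.equivFin.symm k : ℂ)
  have hrange : Set.range ℓ = (Λ : Set ℂ) := by
    ext m; constructor
    · rintro ⟨k, rfl⟩; exact (Λ.equivFin.symm k).2
    · intro hm; exact ⟨Λ.equivFin ⟨m, hm⟩, by simp [ℓ]⟩
  have hℓalg : ∀ k, IsAlgebraic ℚ (cexp (ℓ k)) := fun k => hΛL (Λ.equivFin.symm k).2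
  -- coordinates
  have hcoef : ∀ j, ∃ c : Fin q → Qb, ∑ k, (c k : ℂ) * ℓ k = x j := by
    intro j
    have : x j ∈ Submodule.span Qb (Set.range ℓ) := by rw [hrange]; exact Submodule.span_mono (hTΛ j) (hxT j)
    obtain ⟨c, hc⟩ := (Submodule.mem_span_range_iff_exists_fun Qb).mp this
    exact ⟨c, by simpa [IntermediateField.smul_def] using hc⟩
  have hcoef' : ∀ j, ∃ c : Fin q → Qb, ∑ k, (c k : ℂ) * ℓ k = t * a j := by
    intro j
    have : t * a j ∈ Submodule.span Qb (Set.range ℓ) := by rw [hrange]; exact Submodule.span_mono (hT'Λ j) (htT' j)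
    obtain ⟨c, hc⟩ := (Submodule.mem_span_range_iff_exists_fun Qb).mp this
    exact ⟨c, by simpa [IntermediateField.smul_def] using hc⟩
  choose β hβ using hcoef
  choose β' hβ' using hcoef'
  refine false_of_setting ℓ hℓalg t ht a ha (fun j => (β₀ j : ℂ)) (fun j k => (β j k : ℂ)) (fun j k => (β' j k : ℂ))
    (fun j => mem_algebraicClosure_iff.mp (β₀ j).2) (fun j k => mem_algebraicClosure_iff.mp (β j k).2)
    (fun j k => mem_algebraicClosure_iff.mp (β' j k).2) (fun j => ?_) (fun j => (hβ' j).symm)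
  rw [hβ j]; exact hax j

/-- **The strong six exponentials theorem in the pencil case.** A `2 × 3` matrix with entries in
`L̃` whose rows are linearly independent over `ℚ̄` and whose columns are linearly independent over
`ℚ̄`, and such that some non-trivial `ℚ̄`-combination of its rows has entries in `ℚ̄·L` (no constant
terms), has rank `2`. [cite: Waldschmidt2005, Thm 2.1 via Thm 3.1 (d = 2), pencil (constant-rank ≤ 1) case] -/
theorem strongSix_of_pencil (M : Matrix (Fin 2) (Fin 3) ℂ) (hM : ∀ i j, M i j ∈ logLinearForms)
    (hrow : LinearIndependent (algebraicClosure ℚ ℂ) (fun i => M i))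
    (hcol : LinearIndependent (algebraicClosure ℚ ℂ) (fun j => M.transpose j))
    (γ : Fin 2 → algebraicClosure ℚ ℂ) (hγ : γ ≠ 0)
    (hpen : ∀ j, ∑ i, (γ i : ℂ) * M i j ∈ Submodule.span (algebraicClosure ℚ ℂ) {z : ℂ | IsAlgebraic ℚ (cexp z)}) :
    M.rank = 2 := by
  classical
  by_contra hrank
  -- the rows are `ℂ`-dependent
  have hdep : ¬ LinearIndependent ℂ (fun i => M i) := by
    intro hind
    apply hrank
    rw [Matrix.rank_eq_finrank_span_row, show M.row = fun i => M i from rfl, finrank_span_eq_card hind, Fintype.card_fin]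
  obtain ⟨c, hc, i₀, hi₀⟩ := Fintype.not_linearIndependent_iff.mp hdep
  have hcj : ∀ j, c 0 * M 0 j + c 1 * M 1 j = 0 := fun j => by
    have := congrFun hc j; simpa [Fin.sum_univ_two] using this
  -- no row of `M` vanishes, no `ℚ̄`-combination of the rows vanishes
  have hrow' : ∀ κ : Fin 2 → Qb, (∀ j, (κ 0 : ℂ) * M 0 j + (κ 1 : ℂ) * M 1 j = 0) → κ = 0 := by
    intro κ h
    have := Fintype.linearIndependent_iff.mp hrow κ (by
      funext j; simpa [Fin.sum_univ_two, IntermediateField.smul_def] using h j)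
    funext i; exact this i
  -- Case analysis on `γ 1`
  by_cases hγ1 : γ 1 ≠ 0
  · -- `δ = (1, 0)`: `a' = M 0`, `b' = γ·M`
    by_cases hc1 : c 1 = 0
    · -- then `c 0 ≠ 0` and `M 0 = 0`
      have hc0 : c 0 ≠ 0 := by
        intro h; apply hi₀; fin_cases i₀ <;> assumption
      have hM0 : ∀ j, M 0 j = 0 := fun j => by
        have := hcj j; rw [hc1, zero_mul, add_zero] at this
        exact (mul_eq_zero.mp this).resolve_left hc0
      have := hrow' (fun i => if i = 0 then 1 else 0) (fun j => by simp [hM0 j])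
      exact (one_ne_zero (α := Qb)) (by simpa using congrFun this 0)
    · set t' : ℂ := (γ 0 : ℂ) - (γ 1 : ℂ) * (c 0 / c 1) with ht'
      have hM1 : ∀ j, M 1 j = -(c 0 / c 1) * M 0 j := fun j => by
        have := hcj j; field_simp; linear_combination this
      have hb : ∀ j, ∑ i, (γ i : ℂ) * M i j = t' * M 0 j := fun j => by
        rw [Fin.sum_univ_two, hM1, ht']; ring
      -- `t'` is transcendental
      have ht'T : Transcendental ℚ t' := by
        intro halg
        -- `(γ 0 - t') M 0 + γ 1 M 1 = 0` with algebraic coefficients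
        let τ : Qb := ⟨t', mem_algebraicClosure_iff.mpr halg⟩
        have := hrow' (fun i => if i = 0 then γ 0 - τ else γ 1) (fun j => by
          simp only [if_true, show (1 : Fin 2) ≠ 0 from by decide, if_false]
          have := hb j
          rw [Fin.sum_univ_two] at this
          push_cast
          simp only [τ]
          linear_combination this)
        have h1 := congrFun this 1
        simp only [show (1 : Fin 2) ≠ 0 from by decide, if_false, Pi.zero_apply] at h1
        exact hγ1 h1
      -- `a' = M 0` is independent over `ℚ̄`
      have ha' : LinearIndependent Qb (fun j => M 0 j) := by
        rw [Fintype.linearIndependent_iff]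
        intro g hg j
        -- `∑ g_j col_j = 0`
        have hg0 : ∑ j', (g j' : ℂ) * M 0 j' = 0 := by simpa [IntermediateField.smul_def] using hg
        have hg1 : ∑ j', (g j' : ℂ) * M 1 j' = 0 := by
          have : ∑ j', (g j' : ℂ) * M 1 j' = -(c 0 / c 1) * ∑ j', (g j' : ℂ) * M 0 j' := by
            rw [Finset.mul_sum]; exact Finset.sum_congr rfl fun j' _ => by rw [hM1]; ring
          rw [this, hg0, mul_zero]
        have hsum : ∑ j', g j' • M.transpose j' = 0 := by
          funext i
          simp only [Finset.sum_apply, Pi.smul_apply, Matrix.transpose_apply, Pi.zero_apply, IntermediateField.smul_def,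
            smul_eq_mul]
          rcases Fin.exists_fin_two.mp ⟨i, rfl⟩ with h | h <;> rw [h]
          · exact hg0
          · exact hg1
        exact Fintype.linearIndependent_iff.mp hcol g hsum j
      exact false_of_pencil_data t' ht'T (fun j => M 0 j) ha' (fun j => hM 0 j) (fun j => by rw [← hb j]; exact hpen j)
  · -- `γ 1 = 0`, so `γ 0 ≠ 0`; `δ = (0, 1)`: `a' = M 1`, `b' = γ 0 M 0`
    push Not at hγ1
    have hγ0 : γ 0 ≠ 0 := by
      intro h; apply hγ; funext i; fin_cases i <;> simp [h, hγ1]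
    by_cases hc0 : c 0 = 0
    · have hc1 : c 1 ≠ 0 := by
        intro h; apply hi₀; fin_cases i₀ <;> assumption
      have hM1 : ∀ j, M 1 j = 0 := fun j => by
        have := hcj j; rw [hc0, zero_mul, zero_add] at this
        exact (mul_eq_zero.mp this).resolve_left hc1
      have := hrow' (fun i => if i = 1 then 1 else 0) (fun j => by simp [hM1 j])
      exact (one_ne_zero (α := Qb)) (by simpa using congrFun this 1)
    · set t' : ℂ := -(γ 0 : ℂ) * (c 1 / c 0) with ht'
      have hM0 : ∀ j, M 0 j = -(c 1 / c 0) * M 1 j := fun j => by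
        have := hcj j; field_simp; linear_combination this
      have hb : ∀ j, ∑ i, (γ i : ℂ) * M i j = t' * M 1 j := fun j => by
        rw [Fin.sum_univ_two, hM0, ht', hγ1]; push_cast; ring
      have ht'T : Transcendental ℚ t' := by
        intro halg
        let τ : Qb := ⟨t', mem_algebraicClosure_iff.mpr halg⟩
        have := hrow' (fun i => if i = 0 then γ 0 else -τ) (fun j => by
          simp only [if_true, show (1 : Fin 2) ≠ 0 from by decide, if_false]
          have := hb j
          rw [Fin.sum_univ_two, hγ1] at this
          push_cast at this ⊢
          simp only [τ]
          linear_combination this)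
        have h0 := congrFun this 0
        simp only [if_true, Pi.zero_apply] at h0
        exact hγ0 h0
      have ha' : LinearIndependent Qb (fun j => M 1 j) := by
        rw [Fintype.linearIndependent_iff]
        intro g hg j
        have hg1 : ∑ j', (g j' : ℂ) * M 1 j' = 0 := by simpa [IntermediateField.smul_def] using hg
        have hg0 : ∑ j', (g j' : ℂ) * M 0 j' = 0 := by
          have : ∑ j', (g j' : ℂ) * M 0 j' = -(c 1 / c 0) * ∑ j', (g j' : ℂ) * M 1 j' := by
            rw [Finset.mul_sum]; exact Finset.sum_congr rfl fun j' _ => by rw [hM0]; ring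
          rw [this, hg1, mul_zero]
        have hsum : ∑ j', g j' • M.transpose j' = 0 := by
          funext i
          simp only [Finset.sum_apply, Pi.smul_apply, Matrix.transpose_apply, Pi.zero_apply, IntermediateField.smul_def,
            smul_eq_mul]
          rcases Fin.exists_fin_two.mp ⟨i, rfl⟩ with h | h <;> rw [h]
          · exact hg0
          · exact hg1
        exact Fintype.linearIndependent_iff.mp hcol g hsum j
      exact false_of_pencil_data t' ht'T (fun j => M 1 j) ha' (fun j => hM 1 j) (fun j => by rw [← hb j]; exact hpen j)

end Core

end Literature.NumberTheory.Transcendental.StrongSixExponentials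

end
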